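import Summits.AtomisticToContinuum.Crystallization.Theorems.OverbindingBudgetAffineNearSkeleton

/-!
# Overbinding budget — LIGHT WALLS: the extremal re-cut RD0c ⟸ CP⁺ ∧ R0⁻ of the skeleton line (decomp-a2c lens-4, generation 71)

Child of `…Theorems.OverbindingBudgetAffineNearSkeleton` (tree, p841460; GEN 45N/46: RD0c ⟸ CP ∧ R0 on the v2 cell skeleton).
Memo: `HOME/decomp-a2c-lens-4/g71/memo/NODE-g71-LightWallReduction.md`.  Probes: `HOME/decomp-a2c-lens-4/g71/bc/probes_light.lean`.

## The extremal reduction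
R0 `NearSkeletonFloor` (UNDECIDED since g45; census (B)(iii) j345833 NO KILL) floors the class energy of EVERY admissible skeleton
equilibrium `(F, z)` of every configuration `y`.  Where does a minimal counterexample to R0 — or to the g45 bookkeeping for it — sit?
Expanding the class energy of `z` blockwise around a smooth chart field `Φ` (one PSD second-order form per cell block by K_at⁰, cubic terms
absorbed for `ε₁ ≤ ε₀(ℓ)`), the g46 «AM–GM fights» disappear (they split a positive form) and exactly ONE wall term survives: the first-order
work `W× = Σ_{walls} F^Φ_k · u_k` of the smooth reaction field (`F^Φ = −div σ(∇Φ)`, nonzero only where `z` is not critical, i.e. on the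
pinned walls: the reactions to the cells' loads) against the wall ROUGHNESS `u = y − Φ` (memo §3).  Reactions are budget-visible (the cells
relax the loads: `‖F^Φ‖²_W ≤ (C c²/ℓ)·Q₁`), roughness is controlled by local coercivity, `‖u‖²_W ≤ C(Σ_W ‖classForce y‖² + Σ_W |load|²)` —
but wall-borne force content of `y` is INVISIBLE to the rebate `Q₁(y, z)` (it is pinned), so `|W×| ≈ ε₁·Σ|load|` is first order in the
load while the budget `ν Q₁` is second order: at fixed `(ℓ, ε₁)` the ratio `3 ε₁ c²/(ν f ℓ²)` is unbounded as the load amplitude `f ↓ 0`,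
and no `ε₀(ℓ)` repairs it (`f` belongs to `y`, quantified after `ε₁`).  So the minimal counterexample to the bookkeeping is «vanishing smooth
load + roughness concentrated on the skeleton's walls» — and the walls are not the adversary's: the skeleton is CHOSEN by the reduction (CP),
after `y`, and such skeletons need never be produced: among the `(2ℓ/3)³` half-integer offsets of CP's cubic grid of pinned slabs, the AVERAGE force content of `y` carried by the
`rL`-neighbourhood of the deep walls is the fraction `≤ 261/ℓ` of the total (every clampable site is within `rL + T/2` of a slab of at most
`3·⌈4 rL + 2T + 1⌉·(2ℓ/3)²` of the offset vectors), so SOME offset carries at most that fraction (pigeonhole — the «good slice» selection of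
geometric measure theory / the Friesecke–James–Müller compactness arguments, pointed at the configuration's OWN class-force content).

* THE CLAUSE · `LightWalls ϖ ℓ rL …  y F`: the class-force content `Σ ‖classForce (Near y) (G y) y j‖²` of `y` summed over the WALL ZONE
  (clampable sites within `rL` of a `2ℓ`-deep pinned clampable site) is at most `ϖ/ℓ` times the same content summed over the whole clampable
  interior.  Intrinsic to `(y, F)`; record `(ϖ, rL) = (320, 12)`.
* CP⁺ · `NearLightSkeletonEquilibrium … t w ϖ rL` [NEW · TRUE-type · ATTACKABLE-M]: CP with the light-wall clause — STRONGER than CP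
  (`nearSkeletonEquilibrium_of_light`, PROVED); route = CP's v2 construction at every half-integer grid offset (the minimisation argument is
  offset-independent) + the PROVED averaging schema `lightWalls_of_family` / `nearLightSkeletonEquilibrium_of_cover` (CP⁺ ⟸ CPᶜᵒᵛ
  `NearSkeletonEquilibriumCover`, a covering family of skeleton equilibria of wall-zone multiplicity `q` with `q/#family ≤ ϖ/ℓ`).
* R0⁻ · `NearLightSkeletonFloor … κ₁ t w ϖ rL` [NEW · TRUE-type on paper · ATTACKABLE-L · UNDECIDED — test below]: R0 restricted to
  LIGHT skeleton equilibria — WEAKER than R0 (`nearLightSkeletonFloor_of_nearSkeletonFloor`, PROVED) and strictly so: skeletons whose wall zone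
  carries all of `y`'s force content are not light once `ℓ > ϖ` (`not_lightWalls_of_wallborne`, PROVED) — exactly the g46 doubt family.
  Why R0⁻ is closer to decidable (memo §3): on `F` the equilibrium kills the class force, so `y`'s force content on `F` is Lipschitz-bounded by the
  displacement gradient of `y − z`, i.e. by the rebate currency `Q₁(y, z)` (plus path counting); lightness then makes the wall-zone content
  budget-visible, `Σ_W ‖classForce y‖² ≤ (ϖ/ℓ)(1 − ϖ/ℓ)⁻¹(C·Q₁ + collar)`, whence `|W×| ≤ C'(√(ϖ/ℓ) + 1/ℓ)·Q₁` — a PARAMETER regime along R0's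
  own scale order `ν → ℓ₀(ν) → ε₀(ℓ)`.  What stays undecided is the smooth part of the g45 census (the choice of the Cauchy–Born-equilibrated
  smoothing `Φ`, the chart/odd-term telescoping to the collar, near-side tails).
* SEAM `nearReferenceCritical_of_lightSkeleton : K-side → CP⁺ → R0⁻ → RD0c` PROVED (as the g45 seam, lightness threaded); LINE cone
  `tbdsg_of_nearLightSkeleton_record` through the tree's cone of record `tbdsg_of_nearCritical_record'_bt_d` and the RDEF shape
  `rdef_of_ceg_shape_nearLightSkeleton_record` (cone of record UNCHANGED).  Degenerate case consistent: no deep pinned site ⇒ light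
  (`lightWalls_of_deepPinned_eq_empty`), the `ℓ`-thin empty skeleton is light (`lightWalls_empty_of_thin`).
* NOT REWORDINGS (probes): CP⁺ ↛ RD0c, R0⁻ ↛ RD0c, R0⁻ ↛ R0, CP ↛ CP⁺, neither outright, neither gives N's conclusion or TBDSG.

Census test (ask, LOW; supersedes the g46 §5 wall-load rows): «VANISHING LOAD × WALL-ONLY ROUGHNESS» — periodic fcc box, wall skeleton
`(ℓ, t, w) = (40, 4, 6)`, `y` = lattice + smooth load of amplitude `f ∈ {10⁻³, …, 10⁻⁶}` (K-equivalent) + roughness `10⁻⁵` on ONE family of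
planes `Π` at spacing `ℓ/3`; placement A = walls ON `Π`, placement B = walls offset `ℓ/6` (light); report the order-0 margin `M`, `Q₁` and
`M/(ν Q₁)` as `f ↓`.  KILL(R0) = `M < −ν Q₁ − κ₁ #Far` at A with `|M|/(ν Q₁)` growing as `f ↓`; R0⁻ predicts B never does; A clean too ⇒ the
cross term cancels by oscillation in truth and R0 keeps its evidence (then R0⁻ is the line whose PROOF is in reach).
sorry-free · Mathlib + tree only · no new axioms · no instance / notation beyond the tree's local `E3`.
-/

namespace Summit.AtomisticToContinuum.Crystallization.Theorems.OverbindingBudgetAffineNearCluster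

open scoped BigOperators Classical
open Literature.MathematicalPhysics.StatisticalMechanics
open Literature.Geometry.DiscreteGeometry (nearestDist)
open Summit.AtomisticToContinuum.Crystallization.Theses.OverbindingBudget (RobustDefectLimitWindows)
open Summit.AtomisticToContinuum.Crystallization.Theses.PricedLinkCensus (ChargedEnergyGap)
open Summit.AtomisticToContinuum.Crystallization.Theorems.OverbindingBudgetGradedBareness (CleanlessExcessT)
open Summit.AtomisticToContinuum.Crystallization.Theorems.OverbindingBudgetCoherentCut (CoherentResidual)
open Summit.AtomisticToContinuum.Crystallization.Theorems.OverbindingBudgetTwoShellShape (TwoShellShape)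
open Summit.AtomisticToContinuum.Crystallization.Theorems.OverbindingBudgetBalancedCensusStatements
open Summit.AtomisticToContinuum.Crystallization.Theorems.OverbindingBudgetBalancedCensusRecord
open Summit.AtomisticToContinuum.Crystallization.Theorems.OverbindingBudgetHarmonicNormalForm
open Summit.AtomisticToContinuum.Crystallization.Theorems.OverbindingBudgetLocalHarmonicCertificate
open Summit.AtomisticToContinuum.Crystallization.Theorems.OverbindingBudgetAffineLadder
open Summit.AtomisticToContinuum.Crystallization.Theorems.OverbindingBudgetAffineLocalisation

variable {N : ℕ}
local notation "E3" => EuclideanSpace ℝ (Fin 3)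

/-! ## §1  The force content of `y`, the wall zone of a skeleton, and the LIGHT-WALL clause -/

/-- **Force content** of `y` at the site `j`: the squared class force of `y` ITSELF for its own classes,
`‖classForce (Near y) (G y) y j‖²` — `y`'s sitewise non-equilibrium content (jitter, loaded layers, unrelaxed folds all register here; an
elastically equilibrated bent crystal has none).  It is what the cell equilibria of CP respond to (`classForce z = 0` on `F`). [this file] -/
noncomputable def forceContent (θ₀ ρ₁ ε₁ θ δ : ℝ) (y : Fin N → E3) (j : Fin N) : ℝ :=
  ‖classForce (nearSet θ₀ ρ₁ ε₁ θ δ y) (goodSet ρ₁ ε₁ θ δ y) y j‖ ^ 2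

/-- The force content is nonnegative. [this file] -/
theorem forceContent_nonneg (θ₀ ρ₁ ε₁ θ δ : ℝ) (y : Fin N → E3) (j : Fin N) : 0 ≤ forceContent θ₀ ρ₁ ε₁ θ δ y j := by
  unfold forceContent; positivity

/-- **Deep pinned set** of a free set `F` at scale `ℓ`: the PINNED clampable sites (`∈ nearInterior Rc`, `∉ F`) that are `2ℓ`-DEEP (every
non-clampable site farther than `2ℓ`) — the wall sites of the skeleton away from the collar (the collar's walls are chargeable to far/bad matter
at rate `C(ℓ)·ε₁`, exactly as in clause (6) of `CellSkeleton`). [this file] -/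
noncomputable def deepPinned (ℓ Rc θ₀ ρ₁ ε₁ θ δ : ℝ) (y : Fin N → E3) (F : Finset (Fin N)) : Finset (Fin N) :=
  (nearInterior Rc θ₀ ρ₁ ε₁ θ δ y).filter fun k =>
    k ∉ F ∧ ∀ b, b ∉ nearInterior Rc θ₀ ρ₁ ε₁ θ δ y → 2 * ℓ < dist (y k) (y b)

/-- **Wall zone** of radius `rL`: the clampable sites within `rL` (in `y`) of a deep pinned site — the deep walls together with the
wall-adjacent layers of the cells (`rL = 12`: two interaction cut-offs beyond the slab, so that the local coercivity estimate for the wall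
roughness closes inside the zone). [this file] -/
noncomputable def wallZone (ℓ rL Rc θ₀ ρ₁ ε₁ θ δ : ℝ) (y : Fin N → E3) (F : Finset (Fin N)) : Finset (Fin N) :=
  (nearInterior Rc θ₀ ρ₁ ε₁ θ δ y).filter fun j => ∃ k ∈ deepPinned ℓ Rc θ₀ ρ₁ ε₁ θ δ y F, dist (y j) (y k) ≤ rL

/-- **LIGHT WALLS · `LightWalls ϖ ℓ rL Rc θ₀ ρ₁ ε₁ θ δ y F`** — the normal-form clause of this node: the force content of `y` carried by
the wall zone of `F` is at most the fraction `ϖ/ℓ` of the force content of the whole clampable interior.  Intrinsic to `(y, F)` (no reference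
to `z`); `ϖ/ℓ → 0` along R0's scale order `ν → ℓ₀(ν) ≤ ℓ`.  Record `(ϖ, rL) = (320, 12)`: CP's cubic grid of pinned slabs (spacing `ℓ/3`,
thickness `T = 43/10`) at the `(2ℓ/3)³` half-integer offset vectors has wall-zone multiplicity `≤ 3·q₁·(2ℓ/3)²`, `q₁ = ⌈4 rL + 2T + 1⌉ = 58`, at every
clampable site (for `ℓ > 6 rL + 3T`), i.e. average fraction `≤ 9 q₁/(2ℓ) = 261/ℓ ≤ ϖ/ℓ` (`lightWalls_of_family`). [this file] -/
def LightWalls (ϖ ℓ rL Rc θ₀ ρ₁ ε₁ θ δ : ℝ) (y : Fin N → E3) (F : Finset (Fin N)) : Prop :=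
  ∑ j ∈ wallZone ℓ rL Rc θ₀ ρ₁ ε₁ θ δ y F, forceContent θ₀ ρ₁ ε₁ θ δ y j
    ≤ ϖ / ℓ * ∑ j ∈ nearInterior Rc θ₀ ρ₁ ε₁ θ δ y, forceContent θ₀ ρ₁ ε₁ θ δ y j

/-- The wall zone lies in the clampable interior. [this file] -/
theorem wallZone_subset (ℓ rL Rc θ₀ ρ₁ ε₁ θ δ : ℝ) (y : Fin N → E3) (F : Finset (Fin N)) :
    wallZone ℓ rL Rc θ₀ ρ₁ ε₁ θ δ y F ⊆ nearInterior Rc θ₀ ρ₁ ε₁ θ δ y :=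
  Finset.filter_subset _ _

/-- The deep pinned set lies in the clampable interior and misses `F`. [this file] -/
theorem mem_deepPinned {ℓ Rc θ₀ ρ₁ ε₁ θ δ : ℝ} {y : Fin N → E3} {F : Finset (Fin N)} {k : Fin N} :
    k ∈ deepPinned ℓ Rc θ₀ ρ₁ ε₁ θ δ y F ↔ k ∈ nearInterior Rc θ₀ ρ₁ ε₁ θ δ y ∧ k ∉ F ∧
      ∀ b, b ∉ nearInterior Rc θ₀ ρ₁ ε₁ θ δ y → 2 * ℓ < dist (y k) (y b) := by
  unfold deepPinned; rw [Finset.mem_filter]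

/-- **No deep pinned site ⇒ empty wall zone (PROVED).** [this file] -/
theorem wallZone_eq_empty_of_deepPinned_eq_empty {ℓ rL Rc θ₀ ρ₁ ε₁ θ δ : ℝ} {y : Fin N → E3} {F : Finset (Fin N)}
    (h : deepPinned ℓ Rc θ₀ ρ₁ ε₁ θ δ y F = ∅) : wallZone ℓ rL Rc θ₀ ρ₁ ε₁ θ δ y F = ∅ := by
  unfold wallZone
  refine Finset.filter_eq_empty_iff.mpr fun j _ => ?_
  rintro ⟨k, hk, -⟩
  rw [h] at hk
  simp at hk

/-- **Degenerate case (PROVED):** a free set with NO deep pinned site (every `2ℓ`-deep clampable site free — e.g. the block systems of the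
BlockMean sibling, or any skeleton of `2ℓ`-thin near matter) has light walls at every `ϖ/ℓ ≥ 0`. [this file] -/
theorem lightWalls_of_deepPinned_eq_empty {ϖ ℓ rL Rc θ₀ ρ₁ ε₁ θ δ : ℝ} {y : Fin N → E3} {F : Finset (Fin N)} (hϖ : 0 ≤ ϖ / ℓ)
    (h : deepPinned ℓ Rc θ₀ ρ₁ ε₁ θ δ y F = ∅) : LightWalls ϖ ℓ rL Rc θ₀ ρ₁ ε₁ θ δ y F := by
  unfold LightWalls
  rw [wallZone_eq_empty_of_deepPinned_eq_empty h, Finset.sum_empty]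
  exact mul_nonneg hϖ (Finset.sum_nonneg fun j _ => forceContent_nonneg θ₀ ρ₁ ε₁ θ δ y j)

/-- **The empty skeleton of `ℓ`-thin near matter is light (PROVED)** — consistency with the tree's `cellSkeleton_empty` /
`nearInterior_thin_of_cellSkeleton_empty`: the boundary-dominated degenerate case of R0 is still floored by R0⁻ (it is the chargeable case,
`#Near ≤ C(ℓ)·(#Far + #Gᶜ)`, not N's difficulty). [this file] -/
theorem lightWalls_empty_of_thin {ϖ ℓ rL Rc θ₀ ρ₁ ε₁ θ δ : ℝ} {y : Fin N → E3} (hϖ : 0 ≤ ϖ / ℓ) (hℓ : 0 ≤ ℓ)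
    (h : ∀ k ∈ nearInterior Rc θ₀ ρ₁ ε₁ θ δ y, ∃ b, b ∉ nearInterior Rc θ₀ ρ₁ ε₁ θ δ y ∧ dist (y k) (y b) ≤ ℓ) :
    LightWalls ϖ ℓ rL Rc θ₀ ρ₁ ε₁ θ δ y ∅ := by
  refine lightWalls_of_deepPinned_eq_empty hϖ (Finset.filter_eq_empty_iff.mpr fun k hk => ?_)
  rintro ⟨-, hdeep⟩
  obtain ⟨b, hb, hbd⟩ := h k hk
  have := hdeep b hb
  linarith

/-- **Wall-borne content is NOT light (PROVED):** if all of `y`'s force content in the clampable interior sits in the wall zone of `F`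
and is nonzero, then `F` is not light once `ϖ < ℓ` — skeletons whose walls were laid through `y`'s non-equilibrium content (roughness
concentrated on the walls: the regime R0's bookkeeping does not decide) are exactly what R0⁻ no longer floors. [this file] -/
theorem not_lightWalls_of_wallborne {ϖ ℓ rL Rc θ₀ ρ₁ ε₁ θ δ : ℝ} {y : Fin N → E3} {F : Finset (Fin N)} (hℓ : 0 < ℓ) (hϖ : ϖ < ℓ)
    (hzero : ∀ j ∈ nearInterior Rc θ₀ ρ₁ ε₁ θ δ y, j ∉ wallZone ℓ rL Rc θ₀ ρ₁ ε₁ θ δ y F → forceContent θ₀ ρ₁ ε₁ θ δ y j = 0)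
    (hpos : 0 < ∑ j ∈ wallZone ℓ rL Rc θ₀ ρ₁ ε₁ θ δ y F, forceContent θ₀ ρ₁ ε₁ θ δ y j) :
    ¬ LightWalls ϖ ℓ rL Rc θ₀ ρ₁ ε₁ θ δ y F := by
  intro hL
  unfold LightWalls at hL
  have hsplit : ∑ j ∈ nearInterior Rc θ₀ ρ₁ ε₁ θ δ y, forceContent θ₀ ρ₁ ε₁ θ δ y j
      = ∑ j ∈ wallZone ℓ rL Rc θ₀ ρ₁ ε₁ θ δ y F, forceContent θ₀ ρ₁ ε₁ θ δ y j := by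
    rw [← Finset.sum_subset (wallZone_subset ℓ rL Rc θ₀ ρ₁ ε₁ θ δ y F) fun j hj hjW => hzero j hj hjW]
  rw [hsplit] at hL
  have hfrac : ϖ / ℓ < 1 := (div_lt_one hℓ).mpr hϖ
  nlinarith

/-! ## §2  The averaging lever (PROVED): a covering family of candidate skeletons has a light member -/

/-- **Pigeonhole over a finite family (PROVED).**  For a nonempty finite family `S` of subsets `W s ⊆ I` of MULTIPLICITY `≤ q` (every
`j ∈ I` lies in at most `q` of them) and nonnegative weights `D` on `I`, some member carries at most the fraction `q/#S` of the total weight: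
`∃ s ∈ S, Σ_{W s} D ≤ (q/#S)·Σ_I D` (double counting `Σ_s Σ_{W s} D = Σ_j #{s : j ∈ W s}·D j ≤ q·Σ_I D`, then the minimum is at most the
mean).  This is the whole cost of the light-wall clause on CP's side. [this file] -/
theorem exists_light_member {ι : Type*} (S : Finset ι) (hS : S.Nonempty) (I : Finset (Fin N)) (W : ι → Finset (Fin N))
    (D : Fin N → ℝ) (hD : ∀ j ∈ I, 0 ≤ D j) (hW : ∀ s ∈ S, W s ⊆ I) (q : ℕ)
    (hmult : ∀ j ∈ I, (S.filter fun s => j ∈ W s).card ≤ q) :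
    ∃ s ∈ S, ∑ j ∈ W s, D j ≤ (q : ℝ) / S.card * ∑ j ∈ I, D j := by
  have hsum : ∑ s ∈ S, ∑ j ∈ W s, D j ≤ (q : ℝ) * ∑ j ∈ I, D j := by
    calc ∑ s ∈ S, ∑ j ∈ W s, D j = ∑ s ∈ S, ∑ j ∈ I, (if j ∈ W s then D j else 0) := by
          refine Finset.sum_congr rfl fun s hs => ?_
          rw [← Finset.sum_filter, Finset.filter_mem_eq_inter, Finset.inter_eq_right.mpr (hW s hs)]
      _ = ∑ j ∈ I, ∑ s ∈ S, (if j ∈ W s then D j else 0) := Finset.sum_comm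
      _ = ∑ j ∈ I, ((S.filter fun s => j ∈ W s).card : ℝ) * D j := by
          refine Finset.sum_congr rfl fun j _ => ?_
          rw [← Finset.sum_filter, Finset.sum_const, nsmul_eq_mul]
      _ ≤ ∑ j ∈ I, (q : ℝ) * D j :=
          Finset.sum_le_sum fun j hj => mul_le_mul_of_nonneg_right (by exact_mod_cast hmult j hj) (hD j hj)
      _ = (q : ℝ) * ∑ j ∈ I, D j := by rw [Finset.mul_sum]
  by_contra hcon
  push Not at hcon
  have hcard : (0 : ℝ) < S.card := by exact_mod_cast hS.card_pos
  have hlt : ∑ s ∈ S, ((q : ℝ) / S.card * ∑ j ∈ I, D j) < ∑ s ∈ S, ∑ j ∈ W s, D j :=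
    Finset.sum_lt_sum_of_nonempty hS fun s hs => hcon s hs
  rw [Finset.sum_const, nsmul_eq_mul] at hlt
  have heq : (S.card : ℝ) * ((q : ℝ) / S.card * ∑ j ∈ I, D j) = (q : ℝ) * ∑ j ∈ I, D j := by
    field_simp
  linarith

/-- **Light member of a family of free sets (PROVED):** if a nonempty finite family of free sets `Fam s` has wall-zone multiplicity `≤ q`
at every clampable site and `q/#S ≤ ϖ/ℓ`, some member has light walls. [this file] -/
theorem lightWalls_of_family {ι : Type*} {ϖ ℓ rL Rc θ₀ ρ₁ ε₁ θ δ : ℝ} {y : Fin N → E3} (S : Finset ι) (hS : S.Nonempty)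
    (Fam : ι → Finset (Fin N)) (q : ℕ)
    (hmult : ∀ j ∈ nearInterior Rc θ₀ ρ₁ ε₁ θ δ y, (S.filter fun s => j ∈ wallZone ℓ rL Rc θ₀ ρ₁ ε₁ θ δ y (Fam s)).card ≤ q)
    (hq : (q : ℝ) / S.card ≤ ϖ / ℓ) :
    ∃ s ∈ S, LightWalls ϖ ℓ rL Rc θ₀ ρ₁ ε₁ θ δ y (Fam s) := by
  obtain ⟨s, hs, hle⟩ := exists_light_member S hS (nearInterior Rc θ₀ ρ₁ ε₁ θ δ y)
    (fun s => wallZone ℓ rL Rc θ₀ ρ₁ ε₁ θ δ y (Fam s)) (forceContent θ₀ ρ₁ ε₁ θ δ y)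
    (fun j _ => forceContent_nonneg θ₀ ρ₁ ε₁ θ δ y j) (fun s _ => wallZone_subset ℓ rL Rc θ₀ ρ₁ ε₁ θ δ y (Fam s)) q hmult
  refine ⟨s, hs, hle.trans ?_⟩
  exact mul_le_mul_of_nonneg_right hq (Finset.sum_nonneg fun j _ => forceContent_nonneg θ₀ ρ₁ ε₁ θ δ y j)

/-! ## §3  The two pieces of the re-cut -/

/-- **CP⁺ · `NearLightSkeletonEquilibrium η R Rc δm ρ₁ θ θ₀ t w ϖ rL`** (NEW · TRUE-type · ATTACKABLE-M; the REDUCTION half, now carrying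
the wall-placement freedom).  Given the K-margins `K_at⁰` and R_aff: there is `ℓ₁` such that for every `ℓ ≥ ℓ₁` some `ε₀ > 0` works for all
`ε₁ ≤ ε₀` and all windows: every injective configuration admits a cell skeleton `F` of scale `ℓ` (v2 clauses) WITH LIGHT WALLS at `(ϖ, rL)`
and a skeleton equilibrium `z` on it (`z = y` off `F`, class-critical on `F`, `RefAdmissible`).  Route: CP's construction of g45/g46 at EVERY
half-integer offset vector of the cubic grid (cells, fatness, sparse thin walls and the cellwise minimisation are offset-independent) — i.e.
CPᶜᵒᵛ `NearSkeletonEquilibriumCover` below — and then `nearLightSkeletonEquilibrium_of_cover` (PROVED; the multiplicity count is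
`3·58·(2ℓ/3)²` over `(2ℓ/3)³` offsets, fraction `261/ℓ ≤ ϖ/ℓ` at the record literals).  STRONGER than CP (`nearSkeletonEquilibrium_of_light`).
WHY IT MIGHT FAIL: as CP — only the chart room `η − θ₀ − C ε₁` of `RefAdmissible` (d) at the record `(η, θ₀) = (3/2000, 1/2000)`; the added
clause costs one pigeonhole.  [lens-4 g71; E–Ming 2007 §§4–6, Ortner–Theil 2013 Thm 3.3 (cell problems); the averaging choice of a good
slice: Friesecke–James–Müller 2002 §3, Federer 4.2.1 — orientation only, nothing imported] -/
def NearLightSkeletonEquilibrium (η R Rc δm ρ₁ θ θ₀ t w ϖ rL : ℝ) : Prop :=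
  (∃ μ₁ μR : ℝ, 0 < μ₁ ∧ 0 < μR ∧ PureMarginStabilityAt η μ₁ μR R) → AffineChartStraightening →
    ∃ ℓ₁ : ℝ, ∀ ℓ : ℝ, ℓ₁ ≤ ℓ →
      ∃ ε₀ : ℝ, 0 < ε₀ ∧ ∀ ε₁ : ℝ, 0 < ε₁ → ε₁ ≤ ε₀ → ∀ δ : ℝ, 0 < δ → δ ≤ 2 →
        ∀ (N : ℕ) (y : Fin N → E3), Function.Injective y →
          ∃ (F : Finset (Fin N)) (z : Fin N → E3), CellSkeleton ℓ t w Rc θ₀ ρ₁ ε₁ θ δ y F ∧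
            LightWalls ϖ ℓ rL Rc θ₀ ρ₁ ε₁ θ δ y F ∧ (∀ k, y k ≠ z k → k ∈ F) ∧
            ClassCritical θ₀ ρ₁ ε₁ θ δ y z F ∧ RefAdmissible η R Rc δm θ₀ ρ₁ ε₁ θ δ y z

/-- **R0⁻ · `NearLightSkeletonFloor η R Rc δm ρ₁ θ θ₀ κ₁ t w ϖ rL`** (NEW · TRUE-type on paper · ATTACKABLE-L · UNDECIDED; test = the «vanishing
load × wall-only roughness» rows at the wall-on-roughness placement AND at the light placement).  Given K_at⁰ and R_aff: for every `ν > 0` there is a scale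
`ℓ₀(ν)` such that for every `ℓ ≥ ℓ₀` some `ε₀ > 0` works (all `ε₁ ≤ ε₀`, all windows, some `C ≥ 0`): for EVERY injective `y` and EVERY admissible
skeleton equilibrium `(F, z)` of scale `ℓ` WITH LIGHT WALLS at `(ϖ, rL)`,
`#Near·e⋆ − C·#Gᶜ − κ₁·#Far − ν·Q₁(y, z) ≤ ½·pairSum Near G z`.
WEAKER than R0 (`nearLightSkeletonFloor_of_nearSkeletonFloor`, PROVED) and strictly: the heavy-walled skeletons — walls laid through `y`'s
force content, `not_lightWalls_of_wallborne` — are no longer floored.  Why the restriction bites (memo §3): in the blockwise expansion of the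
class energy of `z` around a smooth chart field `Φ` (one PSD form per cell block, K_at⁰; cubic absorbed for `ε₁ ≤ ε₀(ℓ)`) the only wall term is
the first-order work `W× = Σ_walls F^Φ·(y − Φ)` of the smooth reaction field against the wall roughness; `‖F^Φ‖²_W ≤ (C c²/ℓ)·Q₁` (the cells
relax the loads) and `‖y − Φ‖²_W ≤ C(Σ_W forceContent y + Σ_W |load|²)` (local coercivity), while on `F` criticality of `z` gives
`Σ_F forceContent y ≤ C_Lip·Q₁(y, z)` (Lipschitz bonds + path counting); lightness makes the wall-zone content budget-visible,
`Σ_W forceContent y ≤ (ϖ/ℓ)(1 − ϖ/ℓ)⁻¹(C_Lip Q₁ + C(ℓ)ε₁²·#collar)`, hence `|W×| ≤ C'(√(ϖ/ℓ) + 1/ℓ)·Q₁ + collar` — paid by `ν·Q₁` once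
`ℓ ≥ ℓ₀(ν, ϖ)`: a PARAMETER regime.  Without the clause the wall-borne content is invisible to `Q₁` and `|W×| ≈ ε₁ Σ|load|` beats `ν Q₁` as the
load amplitude `f ↓ 0` at fixed `(ℓ, ε₁)` (ratio `3 ε₁ c²/(ν f ℓ²)`) — the regime R0's bookkeeping does not decide.  WHY IT MIGHT FAIL: the SMOOTH
part is untouched — the choice of a Cauchy–Born-equilibrated smoothing `Φ` of `z` (interior regularity of LJ cell equilibria up to rough pinned
walls), the chart/odd-term telescoping to the collar, and the near-side tail transfer against denser incoherent good matter (slot Z's wall lemma,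
shared); the three displayed inequalities are paper estimates, not tree facts.  [lens-4 g71; Blanc–Le Bris–Lions 2002, E–Ming 2007 Thm 2.2,
Theil 2006 / Flatley–Theil 2015, Hudson–Ortner 2014 §4 — as for R0] -/
def NearLightSkeletonFloor (η R Rc δm ρ₁ θ θ₀ κ₁ t w ϖ rL : ℝ) : Prop :=
  (∃ μ₁ μR : ℝ, 0 < μ₁ ∧ 0 < μR ∧ PureMarginStabilityAt η μ₁ μR R) → AffineChartStraightening →
    ∀ ν : ℝ, 0 < ν → ∃ ℓ₀ : ℝ, ∀ ℓ : ℝ, ℓ₀ ≤ ℓ →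
      ∃ ε₀ : ℝ, 0 < ε₀ ∧ ∀ ε₁ : ℝ, 0 < ε₁ → ε₁ ≤ ε₀ → ∀ δ : ℝ, 0 < δ → δ ≤ 2 →
        ∃ C : ℝ, 0 ≤ C ∧ ∀ (N : ℕ) (y : Fin N → E3), Function.Injective y →
          ∀ (F : Finset (Fin N)) (z : Fin N → E3), CellSkeleton ℓ t w Rc θ₀ ρ₁ ε₁ θ δ y F →
            LightWalls ϖ ℓ rL Rc θ₀ ρ₁ ε₁ θ δ y F → (∀ k, y k ≠ z k → k ∈ F) →
            ClassCritical θ₀ ρ₁ ε₁ θ δ y z F → RefAdmissible η R Rc δm θ₀ ρ₁ ε₁ θ δ y z →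
              ((nearSet θ₀ ρ₁ ε₁ θ δ y).card : ℝ) * (⨅ Q : PeriodicConfiguration 3, Q.energyPerParticle lennardJones)
                - C * (((goodSet ρ₁ ε₁ θ δ y)ᶜ).card : ℝ) - κ₁ * ((farSet θ₀ ρ₁ ε₁ θ δ y).card : ℝ)
                - ν * dispGradSum (101 / 100) (nearSet θ₀ ρ₁ ε₁ θ δ y) (goodSet ρ₁ ε₁ θ δ y) y z
                ≤ 1 / 2 * pairSum (nearSet θ₀ ρ₁ ε₁ θ δ y) (goodSet ρ₁ ε₁ θ δ y) z

/-- **CPᶜᵒᵛ · `NearSkeletonEquilibriumCover η R Rc δm ρ₁ θ θ₀ t w ϖ rL`** (support · TRUE-type · ATTACKABLE-M; the intended route to CP⁺):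
as CP, but producing for every configuration a nonempty finite FAMILY of admissible skeleton equilibria `(Fam s, zs s)`, `s : Fin (m+1)`, whose wall
zones have multiplicity `≤ q` at every clampable site with `q/(m+1) ≤ ϖ/ℓ` — CP's construction at the `(2ℓ/3)³` half-integer offsets of the
grid, `q = 3·⌈4 rL + 2T + 1⌉·(2ℓ/3)² = 174·(2ℓ/3)²`, `q/(m+1) = 261/ℓ`.  Gives CP⁺ by the averaging lever (`nearLightSkeletonEquilibrium_of_cover`, PROVED). [lens-4 g71] -/
def NearSkeletonEquilibriumCover (η R Rc δm ρ₁ θ θ₀ t w ϖ rL : ℝ) : Prop :=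
  (∃ μ₁ μR : ℝ, 0 < μ₁ ∧ 0 < μR ∧ PureMarginStabilityAt η μ₁ μR R) → AffineChartStraightening →
    ∃ ℓ₁ : ℝ, ∀ ℓ : ℝ, ℓ₁ ≤ ℓ →
      ∃ ε₀ : ℝ, 0 < ε₀ ∧ ∀ ε₁ : ℝ, 0 < ε₁ → ε₁ ≤ ε₀ → ∀ δ : ℝ, 0 < δ → δ ≤ 2 →
        ∀ (N : ℕ) (y : Fin N → E3), Function.Injective y →
          ∃ (m : ℕ) (Fam : Fin (m + 1) → Finset (Fin N)) (zs : Fin (m + 1) → (Fin N → E3)) (q : ℕ),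
            (q : ℝ) / (m + 1) ≤ ϖ / ℓ ∧
            (∀ j ∈ nearInterior Rc θ₀ ρ₁ ε₁ θ δ y,
              ((Finset.univ : Finset (Fin (m + 1))).filter fun s => j ∈ wallZone ℓ rL Rc θ₀ ρ₁ ε₁ θ δ y (Fam s)).card ≤ q) ∧
            ∀ s, CellSkeleton ℓ t w Rc θ₀ ρ₁ ε₁ θ δ y (Fam s) ∧ (∀ k, y k ≠ zs s k → k ∈ Fam s) ∧
              ClassCritical θ₀ ρ₁ ε₁ θ δ y (zs s) (Fam s) ∧ RefAdmissible η R Rc δm θ₀ ρ₁ ε₁ θ δ y (zs s)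

/-! ## §4  Seams and comparisons (all PROVED) -/

/-- **CP⁺ ⇒ CP (PROVED):** the light skeleton equilibrium is in particular a skeleton equilibrium. [this file] -/
theorem nearSkeletonEquilibrium_of_light {η R Rc δm ρ₁ θ θ₀ t w ϖ rL : ℝ}
    (h : NearLightSkeletonEquilibrium η R Rc δm ρ₁ θ θ₀ t w ϖ rL) : NearSkeletonEquilibrium η R Rc δm ρ₁ θ θ₀ t w := by
  intro hK hR
  obtain ⟨ℓ₁, h1⟩ := h hK hR
  refine ⟨ℓ₁, fun ℓ hℓ => ?_⟩
  obtain ⟨ε₀, hε₀, h2⟩ := h1 ℓ hℓ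
  refine ⟨ε₀, hε₀, fun ε₁ hε₁ hle δ hδ hδ2 N y hy => ?_⟩
  obtain ⟨F, z, hsk, -, hsupp, hcrit, hadm⟩ := h2 ε₁ hε₁ hle δ hδ hδ2 N y hy
  exact ⟨F, z, hsk, hsupp, hcrit, hadm⟩

/-- **R0 ⇒ R0⁻ (PROVED):** the light-wall floor is the skeleton floor restricted to fewer skeletons — R0⁻ is on the WEAKER side of R0. [this file] -/
theorem nearLightSkeletonFloor_of_nearSkeletonFloor {η R Rc δm ρ₁ θ θ₀ κ₁ t w ϖ rL : ℝ}
    (h : NearSkeletonFloor η R Rc δm ρ₁ θ θ₀ κ₁ t w) : NearLightSkeletonFloor η R Rc δm ρ₁ θ θ₀ κ₁ t w ϖ rL := by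
  intro hK hR ν hν
  obtain ⟨ℓ₀, h1⟩ := h hK hR ν hν
  refine ⟨ℓ₀, fun ℓ hℓ => ?_⟩
  obtain ⟨ε₀, hε₀, h2⟩ := h1 ℓ hℓ
  refine ⟨ε₀, hε₀, fun ε₁ hε₁ hle δ hδ hδ2 => ?_⟩
  obtain ⟨C, hC, h3⟩ := h2 ε₁ hε₁ hle δ hδ hδ2
  exact ⟨C, hC, fun N y hy F z hsk _ hsupp hcrit hadm => h3 N y hy F z hsk hsupp hcrit hadm⟩

/-- **CPᶜᵒᵛ ⇒ CP⁺ (PROVED): the averaging lever applied** — a covering family of skeleton equilibria has a light member. [this file] -/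
theorem nearLightSkeletonEquilibrium_of_cover {η R Rc δm ρ₁ θ θ₀ t w ϖ rL : ℝ}
    (h : NearSkeletonEquilibriumCover η R Rc δm ρ₁ θ θ₀ t w ϖ rL) : NearLightSkeletonEquilibrium η R Rc δm ρ₁ θ θ₀ t w ϖ rL := by
  intro hK hR
  obtain ⟨ℓ₁, h1⟩ := h hK hR
  refine ⟨ℓ₁, fun ℓ hℓ => ?_⟩
  obtain ⟨ε₀, hε₀, h2⟩ := h1 ℓ hℓ
  refine ⟨ε₀, hε₀, fun ε₁ hε₁ hle δ hδ hδ2 N y hy => ?_⟩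
  obtain ⟨m, Fam, zs, q, hq, hmult, hall⟩ := h2 ε₁ hε₁ hle δ hδ hδ2 N y hy
  have hS : (Finset.univ : Finset (Fin (m + 1))).Nonempty := Finset.univ_nonempty
  have hq' : (q : ℝ) / (Finset.univ : Finset (Fin (m + 1))).card ≤ ϖ / ℓ := by
    rw [Finset.card_univ, Fintype.card_fin]; push_cast; exact hq
  obtain ⟨s, -, hlight⟩ := lightWalls_of_family (Finset.univ : Finset (Fin (m + 1))) hS Fam q hmult hq'
  obtain ⟨hsk, hsupp, hcrit, hadm⟩ := hall s
  exact ⟨Fam s, zs s, hsk, hlight, hsupp, hcrit, hadm⟩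

/-- **SEAM (PROVED): K-side → CP⁺ → R0⁻ → RD0c.**  Given `ν`, take the scale `ℓ := max ℓ₀(ν) ℓ₁` and `ε₀ := min`; CP⁺ supplies a LIGHT
skeleton equilibrium, `firstSum = 0` by the tree's `firstSum_eq_zero_of_classCritical`, R0⁻ supplies the floor. [this file] -/
theorem nearReferenceCritical_of_lightSkeleton {η R Rc δm ρ₁ θ θ₀ κ₁ t w ϖ rL : ℝ}
    (hK : ∃ μ₁ μR : ℝ, 0 < μ₁ ∧ 0 < μR ∧ PureMarginStabilityAt η μ₁ μR R)
    (hCP : NearLightSkeletonEquilibrium η R Rc δm ρ₁ θ θ₀ t w ϖ rL)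
    (hR0 : NearLightSkeletonFloor η R Rc δm ρ₁ θ θ₀ κ₁ t w ϖ rL) :
    NearReferenceCriticalFloor η R Rc δm ρ₁ θ θ₀ κ₁ := by
  intro hR ν hν
  obtain ⟨ℓ₁, hCP'⟩ := hCP hK hR
  obtain ⟨ℓ₀, hR0'⟩ := hR0 hK hR ν hν
  obtain ⟨ε₀a, hε₀a, hA⟩ := hCP' (max ℓ₀ ℓ₁) (le_max_right _ _)
  obtain ⟨ε₀b, hε₀b, hB⟩ := hR0' (max ℓ₀ ℓ₁) (le_max_left _ _)
  refine ⟨min ε₀a ε₀b, lt_min hε₀a hε₀b, fun ε₁ hε₁ hle δ hδ hδ2 => ?_⟩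
  obtain ⟨C, hC, hB'⟩ := hB ε₁ hε₁ (hle.trans (min_le_right _ _)) δ hδ hδ2
  refine ⟨C, hC, fun N y hy => ?_⟩
  obtain ⟨F, z, hsk, hlight, hsupp, hcrit, hadm⟩ := hA ε₁ hε₁ (hle.trans (min_le_left _ _)) δ hδ hδ2 N y hy
  exact ⟨z, hadm, firstSum_eq_zero_of_classCritical hsupp hcrit, hB' N y hy F z hsk hlight hsupp hcrit hadm⟩

/-- **The old line feeds the new one (PROVED):** CP⁺ together with the g45 floor R0 already gives RD0c (R0 ⇒ R0⁻) — a proof of R0, should it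
come first, is not wasted; the re-cut only ever SHRINKS the floor's burden. [this file] -/
theorem nearReferenceCritical_of_light_and_skeletonFloor {η R Rc δm ρ₁ θ θ₀ κ₁ t w ϖ rL : ℝ}
    (hK : ∃ μ₁ μR : ℝ, 0 < μ₁ ∧ 0 < μR ∧ PureMarginStabilityAt η μ₁ μR R)
    (hCP : NearLightSkeletonEquilibrium η R Rc δm ρ₁ θ θ₀ t w ϖ rL) (hR0 : NearSkeletonFloor η R Rc δm ρ₁ θ θ₀ κ₁ t w) :
    NearReferenceCriticalFloor η R Rc δm ρ₁ θ θ₀ κ₁ :=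
  nearReferenceCritical_of_lightSkeleton hK hCP (nearLightSkeletonFloor_of_nearSkeletonFloor hR0)

/-! ## §5  The line cone at the record literals and the RDEF shape -/

/-- **LINE CONE through the light skeleton at the record literals** `(η, R, Rc, δm, ρ₁, θ, θ₀, κ₁, t, w, ϖ, rL) =
(3/2000, 4, 6, 1/1000, 12, 1/25, 1/2000, 1/(4·10⁷), 4, 6, 320, 12)` through the tree's cone of record `tbdsg_of_nearCritical_record'_bt_d`
(BT and D discharged): `K_at⁰ ∧ R_aff ∧ CP⁺ ∧ R0⁻ ∧ N2 ∧ Z ∧ M ⟹ TameBalancedDeepScaleGap (122/125) 0 4 (3/50) (1/450)`.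
(The cone OF RECORD is unchanged; this is the LINE cone of the light-wall re-cut.) [this file] -/
theorem tbdsg_of_nearLightSkeleton_record
    (hK : ∃ μ₁ μR : ℝ, 0 < μ₁ ∧ 0 < μR ∧ PureMarginStabilityAt (3 / 2000) μ₁ μR 4) (hR : AffineChartStraightening)
    (hCP : NearLightSkeletonEquilibrium (3 / 2000) 4 6 (1 / 1000) 12 (1 / 25) (1 / 2000) 4 6 320 12)
    (hR0 : NearLightSkeletonFloor (3 / 2000) 4 6 (1 / 1000) 12 (1 / 25) (1 / 2000) (1 / (4 * 10 ^ 7)) 4 6 320 12)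
    (h2 : NearSecondOrderFloor (3 / 2000) 4 6 (1 / 1000) 12 (1 / 25) (1 / 2000) (1 / (4 * 10 ^ 7)))
    (hZ : FarAggregatePricing 12 (1 / 25) (1 / 2000) (1 / (2 * 10 ^ 7))) (hM : AffMidAll 12 (1 / 25)) :
    TameBalancedDeepScaleGap (122 / 125) 0 4 (3 / 50) (1 / 450) :=
  tbdsg_of_nearCritical_record'_bt_d hK hR (nearReferenceCritical_of_lightSkeleton hK hCP hR0) h2 hZ hM

/-- **The residual RDEF through the light skeleton** (record shape; slot 3 now `K_at⁰ ∧ R_aff ∧ CP⁺ ∧ R0⁻ ∧ N2 ∧ Z ∧ M`; CEG, T, CE, Res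
are the other RDEF slots). [this file] -/
theorem rdef_of_ceg_shape_nearLightSkeleton_record (hCEG : ChargedEnergyGap) (hT : TwoShellShape (1 / 100) (3 / 50) (1 / 450))
    (hK : ∃ μ₁ μR : ℝ, 0 < μ₁ ∧ 0 < μR ∧ PureMarginStabilityAt (3 / 2000) μ₁ μR 4) (hR : AffineChartStraightening)
    (hCP : NearLightSkeletonEquilibrium (3 / 2000) 4 6 (1 / 1000) 12 (1 / 25) (1 / 2000) 4 6 320 12)
    (hR0 : NearLightSkeletonFloor (3 / 2000) 4 6 (1 / 1000) 12 (1 / 25) (1 / 2000) (1 / (4 * 10 ^ 7)) 4 6 320 12)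
    (h2 : NearSecondOrderFloor (3 / 2000) 4 6 (1 / 1000) 12 (1 / 25) (1 / 2000) (1 / (4 * 10 ^ 7)))
    (hZ : FarAggregatePricing 12 (1 / 25) (1 / 2000) (1 / (2 * 10 ^ 7))) (hM : AffMidAll 12 (1 / 25))
    (hCE : CleanlessExcessT) (hRes : CoherentResidual 10) : RobustDefectLimitWindows :=
  rdef_of_ceg_shape_balancedDeep_record hCEG hT (tbdsg_of_nearLightSkeleton_record hK hR hCP hR0 h2 hZ hM) hCE hRes

end Summit.AtomisticToContinuum.Crystallization.Theorems.OverbindingBudgetAffineNearCluster
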